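import Summits.BirchSwinnertonDyer.BirchSwinnertonDyer.Theorems.Rank2ObservatoryRank3ModTwoImage
import Summits.BirchSwinnertonDyer.BirchSwinnertonDyer.Theorems.Rank2ObservatoryRank3CMCensus
import Literature.NumberTheory.EllipticCurves.TwoAdicImageSurjectivityModFourProofs
import HarnessLib

/-!
# BirchSwinnertonDyer — rank ≥ 2 observatory: THE 2-ADIC GALOIS IMAGE OF THE RANK-3 TABLE, ROW BY ROW —
# `ρ̄_{E,2ⁿ}` onto `GL₂(ℤ/2ⁿ)` for EVERY `n` on exactly `8 424` of the `9 487` rows; the level of first failure is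
# `2` on `1 016` rows (row 64), `4` on `41`, `8` on `6` — hypothesis-free, from the tree-PROVED Dokchitser–Dokchitser theorem

HONEST FRAMING: per-curve certified theorems and census instruments; no claim on BSD in rank ≥ 2.

WHAT.  Row 64 (`…Rank3ModTwoImage`) decides `ρ̄_{E,2}` onto / not onto on every row of `rank3Table`.  The tree PROVES the
Dokchitser–Dokchitser theorem (`DokchitserDokchitser2012.hasSurjectiveModNGaloisRep_four_iff`, `…_eight_iff`: (2) `ρ̄₄` onto ⟺
`ρ̄₂` onto ∧ `−Δ ∉ ℚ^{×2}` ∧ `∀ t, j ≠ −4t³(t+8)`; (3) `ρ̄₈` onto ⟺ `ρ̄₄` onto ∧ `±2Δ ∉ ℚ^{×2}`), its Lemma in invariant form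
(`exists_root_of_j_eq` / `exists_j_eq_of_root`: `∃ t, j = −4t³(t+8)` ⟺ `64q⁴ + 32Δq + c₄Δ` has a rational root) and the lift
`ρ̄₈` onto ⟹ `ρ̄_{2ⁿ}` onto for all `n` (`hasSurjectiveModNGaloisRep_two_pow_of_eight_holds`).  This file decides all of it per row:
§1 generic corollaries (any elliptic `W/ℚ`); §2 kernel certificates — `adNonSqB d` (`X² − d` rootless modulo a SEARCHED prime `≤ 97`,
row 64's device; `−2Δ` needs `53` once) and `Rank3Row.dd4RootlessB`: the MONIC integer quartic `Q⁴ + 256ΔQ + 64c₄Δ` (`= 64×` the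
D–D quartic at `q = Q/8`) rootless modulo a searched prime `≤ 97` ⟹ no integer root (row 63's `ne_zero_of_noRootModB`) ⟹ no
rational root (integral root theorem over the UFD `ℤ`, Mathlib's `exists_integer_of_is_root_of_monic`); no prime is data.
§3 DATA `adEx` (engine scope `adic_scope.py`; every entry RE-CHECKED by the kernel, incl. `ρ̄₂` onto there): `47` triples `(i, k, v)`
— `k = 0`: `−Δ = v²` (`35` rows); `k = 1`: `v` an integer root of the monic quartic (`6` rows: `v = 0` on the four `j = 0` CM curves
`309123a1/a2, 471969b1/b2`, `58528` on `431644b1`, `−1892` on `447458f1`); `k = 2`: `2Δ = v²` (`499280b1/b2`), `k = 3`: `−2Δ = v²`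
(`359552l1, 377600a1, 403598h1, 480816a1`), both with `ρ̄₄` onto.  §4 the row predicate `Rank3Row.adCheck`, ONE kernel pass per chunk
(`adc01 … adc27`, rows 59/64's indexed walk), `adGo_rank3Table`.  §5 per row `h : rank3Table[i]? = some r`, hypothesis-free:
`Rank3Row.twoAdic_surjective_of_getElem?` (`8 424` rows: `ρ̄_{2ⁿ}` onto for all `n`), `…not_hasSurjectiveModNGaloisRep_four_of_adExAt0
/ …1` (`41` rows: onto at `2`, not at `4`), `…four_not_eight_of_adExAt` (`6` rows: onto at `4`, not at `8`), THE CENSUS STATEMENTS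
`Rank3Row.twoAdic_surjective_iff_of_getElem?` (onto at `8` ⟺ onto at every `2ⁿ` ⟺ off row 64's two lists and off `adEx`) and
`…hasSurjectiveModNGaloisRep_four_iff_of_getElem?`; `twoAdicRows_count` (`8 424`; with row 64: `9 487 = 1 016 + 41 + 6 + 8 424`).
USE: the binder `∀ n, W.HasSurjectiveModNGaloisRep (2 ^ n)` of the tree's `TwoAdicImage*` statements is DISCHARGED BY INDEX on
`8 424` rank-3 curves.  NOT CLAIMED: the image as a subgroup of `GL₂(ℤ₂)` when smaller (Rouse–Zureick-Brown labels), odd `ℓ`,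
table completeness, anything about BSD.  Sources: T. Dokchitser–V. Dokchitser, Math. Z. 272 (2012), Theorem (p. 961), Lemma
(p. 962); Rouse–Zureick-Brown (2015) §3; Silverman AEC III.1 (`c₄`, `Δ`, `j = c₄³/Δ`).
-/

set_option linter.dupNamespace false
set_option autoImplicit false

namespace Summit.BirchSwinnertonDyer.BirchSwinnertonDyer.Rank2Observatory

open Polynomial WeierstrassCurve
open Literature Literature.NumberTheory.EllipticCurves

/-! ## §1 Generic corollaries of the tree-proved Dokchitser–Dokchitser theorem (any elliptic `W/ℚ`) -/
/-- **onto at `4`** from onto at `2`, `−Δ ∉ ℚ^{×2}` and no rational root of `64q⁴ + 32Δq + c₄Δ`.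
[cite: DokchitserDokchitserMathZ2012, Theorem (2) and Lemma] -/
theorem hasSurjectiveModNGaloisRep_four_of (W : WeierstrassCurve ℚ) [W.IsElliptic]
    (h2 : W.HasSurjectiveModNGaloisRep 2) (hΔ₁ : ¬ IsSquare (-W.Δ))
    (hq : ∀ q : ℚ, 64 * q ^ 4 + 32 * W.Δ * q + W.c₄ * W.Δ ≠ 0) : W.HasSurjectiveModNGaloisRep 4 :=
  (DokchitserDokchitser2012.hasSurjectiveModNGaloisRep_four_iff W).mpr
    ⟨h2, hΔ₁, fun _ ht => (DokchitserDokchitser2012.exists_root_of_j_eq W two_ne_zero ht).elim fun q h => hq q h⟩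
/-- **`ρ̄_{E,2ⁿ}` onto for every `n`** from onto at `2`, `−Δ, 2Δ, −2Δ ∉ ℚ^{×2}` and no rational root of the quartic (D–D (2), (3)
and the mod-`8` ⟹ `2`-adic lift, all tree-proved). [cite: DokchitserDokchitserMathZ2012, Theorem] [cite: RouseZureickbrown2015, §3 Lemma] -/
theorem twoAdic_surjective_of (W : WeierstrassCurve ℚ) [W.IsElliptic]
    (h2 : W.HasSurjectiveModNGaloisRep 2) (hΔ₁ : ¬ IsSquare (-W.Δ))
    (hq : ∀ q : ℚ, 64 * q ^ 4 + 32 * W.Δ * q + W.c₄ * W.Δ ≠ 0)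
    (hΔ₂ : ¬ IsSquare (2 * W.Δ)) (hΔ₃ : ¬ IsSquare (-2 * W.Δ)) (n : ℕ) : W.HasSurjectiveModNGaloisRep ((2 : ℤ) ^ n) :=
  hasSurjectiveModNGaloisRep_two_pow_of_eight_holds W ((DokchitserDokchitser2012.hasSurjectiveModNGaloisRep_eight_iff W).mpr
    ⟨hasSurjectiveModNGaloisRep_four_of W h2 hΔ₁ hq, hΔ₂, hΔ₃⟩) n
/-- a rational root of `64q⁴ + 32Δq + c₄Δ` ⟹ `j = −4t³(t+8)` for some `t` ⟹ not onto at `4`.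
[cite: DokchitserDokchitserMathZ2012, Theorem (2) and Lemma] -/
theorem not_hasSurjectiveModNGaloisRep_four_of_root (W : WeierstrassCurve ℚ) [W.IsElliptic] {q : ℚ}
    (hq : 64 * q ^ 4 + 32 * W.Δ * q + W.c₄ * W.Δ = 0) :
    (∃ t : ℚ, W.j = -4 * t ^ 3 * (t + 8)) ∧ ¬ W.HasSurjectiveModNGaloisRep 4 := by
  obtain ⟨t, ht⟩ := DokchitserDokchitser2012.exists_j_eq_of_root W two_ne_zero hq
  exact ⟨⟨t, ht⟩, fun h4 => ((DokchitserDokchitser2012.hasSurjectiveModNGaloisRep_four_iff W).mp h4).2.2 t ht⟩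

/-! ## §2 Kernel certificates: non-squares and «no rational root of the quartic» by a rootless prime -/

/-- the primes searched (least rootless prime over the table: `≤ 53` for the squares, `≤ 97` for the quartic). [folklore] -/
def adPrimes : List ℕ := [3, 5, 7, 11, 13, 17, 19, 23, 29, 31, 37, 41, 43, 47, 53, 59, 61, 67, 71, 73, 79, 83, 89, 97]
/-- `d ∉ ℚ^{×2}` certified: `X² − d` rootless modulo some listed prime (row 64's `nonSqB` with the longer list). [folklore] -/
def adNonSqB (d : ℤ) : Bool := adPrimes.any fun l => noRootModB (sqDefect d) l
/-- soundness of `adNonSqB`. [folklore] -/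
theorem not_isSquare_of_adNonSqB {d : ℤ} (h : adNonSqB d = true) : ¬ IsSquare (d : ℚ) := by
  obtain ⟨l, -, hl⟩ := List.any_eq_true.mp h
  exact not_isSquare_of_noRootModB_sqDefect hl

/-- the monic integer quartic `Q⁴ + 256ΔQ + 64c₄Δ = 64·(64q⁴ + 32Δq + c₄Δ)` at `Q = 8q`, as an integer function.
[cite: DokchitserDokchitserMathZ2012, Lemma] -/
def Rank3Row.dd4 (r : Rank3Row) : ℤ → ℤ := fun Q => Q * Q * Q * Q + 256 * r.delta * Q + 64 * (r.c4 * r.delta)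
/-- the same quartic as a polynomial over `ℤ` (for the integral root theorem). [folklore] -/
noncomputable def Rank3Row.dd4Poly (r : Rank3Row) : ℤ[X] := X ^ 4 + C (256 * r.delta) * X + C (64 * (r.c4 * r.delta))
/-- `z − w ∣ dd4 z − dd4 w`. [folklore] -/
theorem Rank3Row.sub_dvd_dd4 (r : Rank3Row) (z w : ℤ) : z - w ∣ r.dd4 z - r.dd4 w :=
  ⟨z * z * z + z * z * w + z * w * w + w * w * w + 256 * r.delta, by simp only [Rank3Row.dd4]; ring⟩
/-- `dd4Poly` is monic. [folklore] -/
theorem Rank3Row.dd4Poly_monic (r : Rank3Row) : r.dd4Poly.Monic := by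
  unfold Rank3Row.dd4Poly
  monicity!
/-- `aeval q dd4Poly` is the quartic expression. [folklore] -/
theorem Rank3Row.aeval_dd4Poly (r : Rank3Row) (q : ℚ) :
    aeval q r.dd4Poly = q ^ 4 + 256 * (r.delta : ℚ) * q + 64 * ((r.c4 : ℚ) * r.delta) := by
  simp only [Rank3Row.dd4Poly, map_add, map_mul, map_pow, aeval_X, eq_intCast, map_intCast, map_ofNat]
/-- the quartic is certified rootless modulo a listed prime (searched by the kernel). [folklore] -/
def Rank3Row.dd4RootlessB (r : Rank3Row) : Bool := adPrimes.any fun l => noRootModB r.dd4 l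
/-- **rootless prime ⟹ the D–D quartic has no rational root**: a rational root `q` gives the root `8q` of the monic integer
quartic, an integer by the integral root theorem, contradicting row 63's `ne_zero_of_noRootModB`. [cite: DokchitserDokchitserMathZ2012, Lemma] -/
theorem Rank3Row.quartic_ne_zero_of_dd4RootlessB (r : Rank3Row) (h : r.dd4RootlessB = true) (q : ℚ) :
    64 * q ^ 4 + 32 * r.curve.Δ * q + r.curve.c₄ * r.curve.Δ ≠ 0 := by
  intro hq
  rw [Rank3Row.curve_Δ, Rank3Row.curve_c₄] at hq
  have ha : aeval (8 * q) r.dd4Poly = 0 := by rw [r.aeval_dd4Poly]; linear_combination 64 * hq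
  obtain ⟨z, hz, -⟩ := exists_integer_of_is_root_of_monic r.dd4Poly_monic ha
  have hz' : (z : ℚ) = 8 * q := by rw [hz]; simp
  have h0 : ((r.dd4 z : ℤ) : ℚ) = 0 := by
    push_cast [Rank3Row.dd4]
    rw [hz']
    linear_combination 64 * hq
  obtain ⟨l, -, hl⟩ := List.any_eq_true.mp h
  exact ne_zero_of_noRootModB r.sub_dvd_dd4 hl z (by exact_mod_cast h0)
/-- the two level-`4` certificates of a row: `−Δ ∉ ℚ^{×2}` and the quartic rootless. [folklore] -/
def Rank3Row.adCore (r : Rank3Row) : Bool := adNonSqB (-r.delta) && r.dd4RootlessB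

/-! ## §3 Data: the exception list among the `8 471` rows with `ρ̄₂` onto -/

/-- `(i, k, v)`: row `i` has `ρ̄₂` onto and — `k = 0`: `−Δ = v²` (`48734b1/b2, 68890d1/d2, 83582g1, 117438i1, 195938a1, 236034e1,
237006c1, 249158a1, 255717f1, 267168b1, 292378b1, 313168c1, 342726c1/c2, 344736g1, 357858q1/q2, 371522c1/c2, 372490c1/c2, 391878a1,
393198b1, 405262c1, 432814b1/b2, 435342m1, 472384g1, 479622b1, 482162b1, 484626q1, 489854b1, 496202c1`); `k = 1`: `v⁴ + 256Δv +
64c₄Δ = 0` (`309123a1/a2, 431644b1, 447458f1, 471969b1/b2`); `k = 2`: `2Δ = v²` (`499280b1/b2`); `k = 3`: `−2Δ = v²` (`359552l1,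
377600a1, 403598h1, 480816a1`), the last two kinds with `ρ̄₄` onto. [folklore] -/
def adEx : List (ℕ × ℕ × ℤ) :=
  [(120, 0, 3304), (121, 0, 40474), (257, 0, 3320), (258, 0, 20750), (391, 0, 83582), (805, 0, 352314), (2037, 0, 626),
   (2717, 0, 78678), (2743, 0, 158004), (3011, 0, 13468), (3145, 0, 85239), (3414, 0, 534336), (4050, 0, 4118), (4449, 1, 0),
   (4450, 1, 0), (4540, 0, 27232), (5174, 0, 12906), (5175, 0, 5736), (5226, 0, 229824), (5525, 0, 81216), (5526, 0, 45684),
   (5569, 3, 6784), (5871, 0, 27584), (5872, 0, 1724), (5898, 0, 308800), (5899, 0, 12062500), (6050, 3, 47200),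
   (6438, 0, 1175634), (6480, 0, 16614), (6770, 3, 335793536), (6816, 0, 4457882), (7511, 1, 58528), (7546, 0, 142784),
   (7547, 0, 4720796), (7615, 0, 20896416), (7950, 1, -1892), (8644, 1, 0), (8645, 1, 0), (8659, 0, 1889536),
   (8904, 0, 1438866), (8949, 3, 11539584), (8978, 0, 7856), (9040, 0, 2514816), (9190, 0, 7837664), (9394, 0, 151018),
   (9467, 2, 101120), (9468, 2, 1264000)]
/-- the listed `(k, v)` of row `i`, if any. [folklore] -/
def adExAt (i : ℕ) : Option (ℕ × ℤ) := (adEx.find? fun p => p.1 == i).map Prod.snd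

section counts
set_option maxHeartbeats 4000000
/-- `47 = 35 + 6 + 2 + 4` entries, by kind (closed Booleans). [folklore] -/
theorem adEx_kinds : adEx.length = 47 ∧ ((List.range 4).map fun k => (adEx.filter fun p => p.2.1 == k).length) = [35, 6, 2, 4] := by
  constructor <;> decide +kernel
/-- row `i` is off row 64's two lists and off `adEx`. [folklore] -/
def adOff (i : ℕ) : Bool := (redTwoAt i).isNone && (c3At i).isNone && (adExAt i).isNone
/-- lower half-range count (the range is split for the kernel). [folklore] -/
theorem twoAdicRows_count_lo : ((List.range' 0 4744).filter adOff).length = 4285 := by decide +kernel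
/-- upper half-range count. [folklore] -/
theorem twoAdicRows_count_hi : ((List.range' 4744 4743).filter adOff).length = 4139 := by decide +kernel
end counts
/-- **`8 424` rows are off row 64's two lists and off `adEx`** (kernel count over `range 9487`; `8 471 − 47`). [folklore] -/
theorem twoAdicRows_count : ((List.range 9487).filter adOff).length = 8424 := by
  rw [List.range_eq_range', show 9487 = 4744 + 4743 from rfl, ← List.range'_append, List.filter_append, List.length_append,
    Nat.one_mul, Nat.zero_add, twoAdicRows_count_lo, twoAdicRows_count_hi]

/-! ## §4 The row predicate and its one pass over the table -/

/-- row `r` at index `i` passes: on `adEx` the listed certificate holds AND the row is off row 64's two lists (kinds `2, 3` also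
carry the level-`4` certificates); off the list, the level-`4` certificates and `2Δ, −2Δ ∉ ℚ^{×2}` — or (only then consulted) the row
is on one of row 64's lists (`ρ̄₂` not onto; `72` rows reach `redTwoAt`). [folklore] -/
def Rank3Row.adCheck (r : Rank3Row) (i : ℕ) : Bool :=
  match adExAt i with
  | some (0, v) => v * v == -r.delta && (redTwoAt i).isNone && (c3At i).isNone
  | some (1, v) => r.dd4 v == 0 && (redTwoAt i).isNone && (c3At i).isNone
  | some (2, v) => r.adCore && v * v == 2 * r.delta && (redTwoAt i).isNone && (c3At i).isNone
  | some (3, v) => r.adCore && v * v == -2 * r.delta && (redTwoAt i).isNone && (c3At i).isNone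
  | some _ => false
  | none => (r.adCore && adNonSqB (2 * r.delta) && adNonSqB (-2 * r.delta)) || (c3At i).isSome || (redTwoAt i).isSome

/-- `adCheck` along a chunk whose first row has index `i`. [folklore] -/
def adGo : List Rank3Row → ℕ → Bool
  | [], _ => true
  | r :: rs, i => r.adCheck i && adGo rs (i + 1)

/-- `adGo` checks every row of the chunk at its index (structural). [folklore] -/
theorem adGo_getElem? : ∀ (rows : List Rank3Row) (i j : ℕ) (r : Rank3Row),
    adGo rows i = true → rows[j]? = some r → r.adCheck (i + j) = true := by
  intro rows
  induction rows with
  | nil => intro i j r _ h; simp at h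
  | cons r₀ rs ih =>
    intro i j r hgo h
    simp only [adGo, Bool.and_eq_true] at hgo
    cases j with
    | zero =>
      simp only [List.getElem?_cons_zero, Option.some.injEq] at h
      subst h; simpa using hgo.1
    | succ j =>
      simp only [List.getElem?_cons_succ] at h
      have := ih (i + 1) j r hgo.2 h
      rwa [show i + 1 + j = i + (j + 1) by ring] at this

/-- `adGo` splits along an append. [folklore] -/
theorem adGo_append : ∀ (l₁ l₂ : List Rank3Row) (i : ℕ), adGo (l₁ ++ l₂) i = (adGo l₁ i && adGo l₂ (i + l₁.length)) := by
  intro l₁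
  induction l₁ with
  | nil => intro l₂ i; simp [adGo]
  | cons r rs ih =>
    intro l₂ i
    simp only [List.cons_append, adGo, ih, List.length_cons, Bool.and_assoc]
    congr 2
    rw [show i + 1 + rs.length = i + (rs.length + 1) by ring]

section chunks
set_option maxHeartbeats 4000000
/-- chunk `01` (rows `0 … 351`) passes. [folklore] -/ theorem adc01 : adGo rank3Rows01 0 = true := by decide +kernel
/-- chunk `02` (rows `352 … 703`) passes. [folklore] -/ theorem adc02 : adGo rank3Rows02 352 = true := by decide +kernel
/-- chunk `03` (rows `704 … 1055`) passes. [folklore] -/ theorem adc03 : adGo rank3Rows03 704 = true := by decide +kernel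
/-- chunk `04` (rows `1056 … 1407`) passes. [folklore] -/ theorem adc04 : adGo rank3Rows04 1056 = true := by decide +kernel
/-- chunk `05` (rows `1408 … 1759`) passes. [folklore] -/ theorem adc05 : adGo rank3Rows05 1408 = true := by decide +kernel
/-- chunk `06` (rows `1760 … 2111`) passes. [folklore] -/ theorem adc06 : adGo rank3Rows06 1760 = true := by decide +kernel
/-- chunk `07` (rows `2112 … 2463`) passes. [folklore] -/ theorem adc07 : adGo rank3Rows07 2112 = true := by decide +kernel
/-- chunk `08` (rows `2464 … 2815`) passes. [folklore] -/ theorem adc08 : adGo rank3Rows08 2464 = true := by decide +kernel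
/-- chunk `09` (rows `2816 … 3167`) passes. [folklore] -/ theorem adc09 : adGo rank3Rows09 2816 = true := by decide +kernel
/-- chunk `10` (rows `3168 … 3519`) passes. [folklore] -/ theorem adc10 : adGo rank3Rows10 3168 = true := by decide +kernel
/-- chunk `11` (rows `3520 … 3871`) passes. [folklore] -/ theorem adc11 : adGo rank3Rows11 3520 = true := by decide +kernel
/-- chunk `12` (rows `3872 … 4223`) passes. [folklore] -/ theorem adc12 : adGo rank3Rows12 3872 = true := by decide +kernel
/-- chunk `13` (rows `4224 … 4575`) passes. [folklore] -/ theorem adc13 : adGo rank3Rows13 4224 = true := by decide +kernel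
/-- chunk `14` (rows `4576 … 4927`) passes. [folklore] -/ theorem adc14 : adGo rank3Rows14 4576 = true := by decide +kernel
/-- chunk `15` (rows `4928 … 5279`) passes. [folklore] -/ theorem adc15 : adGo rank3Rows15 4928 = true := by decide +kernel
/-- chunk `16` (rows `5280 … 5631`) passes. [folklore] -/ theorem adc16 : adGo rank3Rows16 5280 = true := by decide +kernel
/-- chunk `17` (rows `5632 … 5983`) passes. [folklore] -/ theorem adc17 : adGo rank3Rows17 5632 = true := by decide +kernel
/-- chunk `18` (rows `5984 … 6335`) passes. [folklore] -/ theorem adc18 : adGo rank3Rows18 5984 = true := by decide +kernel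
/-- chunk `19` (rows `6336 … 6687`) passes. [folklore] -/ theorem adc19 : adGo rank3Rows19 6336 = true := by decide +kernel
/-- chunk `20` (rows `6688 … 7039`) passes. [folklore] -/ theorem adc20 : adGo rank3Rows20 6688 = true := by decide +kernel
/-- chunk `21` (rows `7040 … 7391`) passes. [folklore] -/ theorem adc21 : adGo rank3Rows21 7040 = true := by decide +kernel
/-- chunk `22` (rows `7392 … 7743`) passes. [folklore] -/ theorem adc22 : adGo rank3Rows22 7392 = true := by decide +kernel
/-- chunk `23` (rows `7744 … 8095`) passes. [folklore] -/ theorem adc23 : adGo rank3Rows23 7744 = true := by decide +kernel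
/-- chunk `24` (rows `8096 … 8447`) passes. [folklore] -/ theorem adc24 : adGo rank3Rows24 8096 = true := by decide +kernel
/-- chunk `25` (rows `8448 … 8799`) passes. [folklore] -/ theorem adc25 : adGo rank3Rows25 8448 = true := by decide +kernel
/-- chunk `26` (rows `8800 … 9151`) passes. [folklore] -/ theorem adc26 : adGo rank3Rows26 8800 = true := by decide +kernel
/-- chunk `27` (rows `9152 … 9486`) passes. [folklore] -/ theorem adc27 : adGo rank3Rows27 9152 = true := by decide +kernel
end chunks

/-- **the whole table passes** (the `27` chunk passes assembled along `adGo_append`, chunk lengths from row 60). [folklore] -/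
theorem adGo_rank3Table : adGo rank3Table 0 = true := by
  simp only [rank3Table, adGo_append, List.length_append, Nat.reduceAdd, Bool.and_self,
    rank3Rows01_length, rank3Rows02_length, rank3Rows03_length, rank3Rows04_length, rank3Rows05_length,
    rank3Rows06_length, rank3Rows07_length, rank3Rows08_length, rank3Rows09_length, rank3Rows10_length,
    rank3Rows11_length, rank3Rows12_length, rank3Rows13_length, rank3Rows14_length, rank3Rows15_length,
    rank3Rows16_length, rank3Rows17_length, rank3Rows18_length, rank3Rows19_length, rank3Rows20_length,
    rank3Rows21_length, rank3Rows22_length, rank3Rows23_length, rank3Rows24_length, rank3Rows25_length,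
    rank3Rows26_length,
    rank3Rows26_length,
    adc01, adc02, adc03, adc04, adc05, adc06, adc07, adc08, adc09,
    adc10, adc11, adc12, adc13, adc14, adc15, adc16, adc17, adc18,
    adc19, adc20, adc21, adc22, adc23, adc24, adc25, adc26, adc27]

/-- every row passes `adCheck` at its index. [folklore] -/
theorem Rank3Row.adCheck_of_getElem? {i : ℕ} {r : Rank3Row} (h : rank3Table[i]? = some r) : r.adCheck i = true := by
  simpa using adGo_getElem? rank3Table 0 i r adGo_rank3Table h

/-! ## §5 The readings, row by row -/
/-- **kind `0` (`35` rows): `Δ = −v²`, `ρ̄₂` onto, `ρ̄₄` NOT onto.** [cite: DokchitserDokchitserMathZ2012, Theorem (2)] -/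
theorem Rank3Row.not_hasSurjectiveModNGaloisRep_four_of_adExAt0 {i : ℕ} {r : Rank3Row} (h : rank3Table[i]? = some r)
    {v : ℤ} (hk : adExAt i = some (0, v)) :
    r.curve.Δ = -(v : ℚ) ^ 2 ∧ r.curve.HasSurjectiveModNGaloisRep 2 ∧ ¬ r.curve.HasSurjectiveModNGaloisRep 4 := by
  haveI := isElliptic_of_mem (List.mem_of_getElem? h)
  have hc := Rank3Row.adCheck_of_getElem? h
  simp only [Rank3Row.adCheck, hk, Bool.and_eq_true, beq_iff_eq, Option.isNone_iff_eq_none] at hc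
  have hΔ : r.curve.Δ = -(v : ℚ) ^ 2 := by
    rw [Rank3Row.curve_Δ, show r.delta = -(v * v) by omega]; push_cast; ring
  exact ⟨hΔ, Rank3Row.hasSurjectiveModNGaloisRep_two_of_getElem? h hc.1.2 hc.2,
    fun h4 => ((DokchitserDokchitser2012.hasSurjectiveModNGaloisRep_four_iff r.curve).mp h4).2.1 ⟨v, by rw [hΔ]; ring⟩⟩
/-- **kind `1` (`6` rows): `v/8` is a rational root of `64q⁴ + 32Δq + c₄Δ`, so `j = c₄³/Δ = −4t³(t+8)` for some `t ∈ ℚ` (stated as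
`c₄³ = −4t³(t+8)·Δ`); `ρ̄₂` onto, `ρ̄₄` NOT onto.** [cite: DokchitserDokchitserMathZ2012, Theorem (2) and Lemma] -/
theorem Rank3Row.not_hasSurjectiveModNGaloisRep_four_of_adExAt1 {i : ℕ} {r : Rank3Row} (h : rank3Table[i]? = some r)
    {v : ℤ} (hk : adExAt i = some (1, v)) :
    64 * ((v : ℚ) / 8) ^ 4 + 32 * r.curve.Δ * ((v : ℚ) / 8) + r.curve.c₄ * r.curve.Δ = 0 ∧
      (∃ t : ℚ, r.curve.c₄ ^ 3 = -4 * t ^ 3 * (t + 8) * r.curve.Δ) ∧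
      r.curve.HasSurjectiveModNGaloisRep 2 ∧ ¬ r.curve.HasSurjectiveModNGaloisRep 4 := by
  haveI := isElliptic_of_mem (List.mem_of_getElem? h)
  have hc := Rank3Row.adCheck_of_getElem? h
  simp only [Rank3Row.adCheck, hk, Bool.and_eq_true, beq_iff_eq, Option.isNone_iff_eq_none] at hc
  have hq : 64 * ((v : ℚ) / 8) ^ 4 + 32 * r.curve.Δ * ((v : ℚ) / 8) + r.curve.c₄ * r.curve.Δ = 0 := by
    have h0 : ((r.dd4 v : ℤ) : ℚ) = 0 := by exact_mod_cast hc.1.1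
    push_cast [Rank3Row.dd4] at h0
    rw [Rank3Row.curve_Δ, Rank3Row.curve_c₄]
    linear_combination h0 / 64
  obtain ⟨⟨t, ht⟩, hn⟩ := not_hasSurjectiveModNGaloisRep_four_of_root r.curve hq
  exact ⟨hq, ⟨t, by rw [← DokchitserDokchitser2012.j_mul_Δ r.curve, ht]⟩,
    Rank3Row.hasSurjectiveModNGaloisRep_two_of_getElem? h hc.1.2 hc.2, hn⟩
/-- a row with `ρ̄₂` onto whose `adCore` passes has `ρ̄₄` onto. [cite: DokchitserDokchitserMathZ2012, Theorem (2)] -/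
theorem Rank3Row.hasSurjectiveModNGaloisRep_four_of_adCore {i : ℕ} {r : Rank3Row} (h : rank3Table[i]? = some r)
    (hX : redTwoAt i = none) (h3 : c3At i = none) (hc : r.adCore = true) : r.curve.HasSurjectiveModNGaloisRep 4 := by
  haveI := isElliptic_of_mem (List.mem_of_getElem? h)
  simp only [Rank3Row.adCore, Bool.and_eq_true] at hc
  refine hasSurjectiveModNGaloisRep_four_of r.curve (Rank3Row.hasSurjectiveModNGaloisRep_two_of_getElem? h hX h3) ?_
    (r.quartic_ne_zero_of_dd4RootlessB hc.2)
  rw [Rank3Row.curve_Δ]; exact_mod_cast not_isSquare_of_adNonSqB hc.1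
/-- **kinds `2, 3` (`6` rows): `ρ̄₄` onto, `2Δ = v²` resp. `−2Δ = v²`, `ρ̄₈` NOT onto.** [cite: DokchitserDokchitserMathZ2012, Theorem (3)] -/
theorem Rank3Row.four_not_eight_of_adExAt {i : ℕ} {r : Rank3Row} (h : rank3Table[i]? = some r) {k : ℕ} {v : ℤ}
    (hk : adExAt i = some (k, v)) (hk' : k = 2 ∨ k = 3) :
    r.curve.HasSurjectiveModNGaloisRep 4 ∧ (2 * r.curve.Δ = (v : ℚ) ^ 2 ∨ -2 * r.curve.Δ = (v : ℚ) ^ 2) ∧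
      ¬ r.curve.HasSurjectiveModNGaloisRep 8 := by
  haveI := isElliptic_of_mem (List.mem_of_getElem? h)
  have hc := Rank3Row.adCheck_of_getElem? h
  have hsq : (r.adCore = true ∧ redTwoAt i = none ∧ c3At i = none) ∧
      (2 * r.curve.Δ = (v : ℚ) ^ 2 ∨ -2 * r.curve.Δ = (v : ℚ) ^ 2) := by
    rw [Rank3Row.curve_Δ]
    rcases hk' with rfl | rfl <;>
      simp only [Rank3Row.adCheck, hk, Bool.and_eq_true, beq_iff_eq, Option.isNone_iff_eq_none] at hc
    · exact ⟨⟨hc.1.1.1, hc.1.2, hc.2⟩, Or.inl (by exact_mod_cast (show 2 * r.delta = v ^ 2 by rw [← hc.1.1.2]; ring))⟩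
    · exact ⟨⟨hc.1.1.1, hc.1.2, hc.2⟩, Or.inr (by exact_mod_cast (show -2 * r.delta = v ^ 2 by rw [← hc.1.1.2]; ring))⟩
  obtain ⟨⟨hcore, hX, h3⟩, hv⟩ := hsq
  refine ⟨Rank3Row.hasSurjectiveModNGaloisRep_four_of_adCore h hX h3 hcore, hv, fun h8 => ?_⟩
  have h' := (DokchitserDokchitser2012.hasSurjectiveModNGaloisRep_eight_iff r.curve).mp h8
  exact hv.elim (fun hv => h'.2.1 ⟨v, by rw [hv]; ring⟩) fun hv => h'.2.2 ⟨v, by rw [hv]; ring⟩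
/-- **off all lists (`8 424` rows): `ρ̄_{E,2ⁿ}` onto for EVERY `n`** (surjective `2`-adic image, level by level).
[cite: DokchitserDokchitserMathZ2012, Theorem] [cite: RouseZureickbrown2015, §3 Lemma] -/
theorem Rank3Row.twoAdic_surjective_of_getElem? {i : ℕ} {r : Rank3Row} (h : rank3Table[i]? = some r)
    (hX : redTwoAt i = none) (h3 : c3At i = none) (hk : adExAt i = none) (n : ℕ) :
    r.curve.HasSurjectiveModNGaloisRep ((2 : ℤ) ^ n) := by
  haveI := isElliptic_of_mem (List.mem_of_getElem? h)
  have hc := Rank3Row.adCheck_of_getElem? h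
  simp only [Rank3Row.adCheck, Rank3Row.adCore, hk, h3, hX, Option.isSome_none, Bool.or_false, Bool.and_eq_true] at hc
  refine twoAdic_surjective_of r.curve (Rank3Row.hasSurjectiveModNGaloisRep_two_of_getElem? h hX h3) ?_
    (r.quartic_ne_zero_of_dd4RootlessB hc.1.1.2) ?_ ?_ n <;> rw [Rank3Row.curve_Δ]
  · exact_mod_cast not_isSquare_of_adNonSqB hc.1.1.1
  · exact_mod_cast not_isSquare_of_adNonSqB hc.1.2
  · exact_mod_cast not_isSquare_of_adNonSqB hc.2
/-- what `adExAt i = some (k, v)` can be: `k ≤ 3` (else the row check is `false`). [folklore] -/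
theorem Rank3Row.kind_le_three_of_adExAt {i : ℕ} {r : Rank3Row} (h : rank3Table[i]? = some r) {k : ℕ} {v : ℤ}
    (hk : adExAt i = some (k, v)) : k = 0 ∨ k = 1 ∨ k = 2 ∨ k = 3 := by
  have hc := Rank3Row.adCheck_of_getElem? h
  match k, hk, hc with
  | 0, _, _ => exact Or.inl rfl
  | 1, _, _ => exact Or.inr (Or.inl rfl)
  | 2, _, _ => exact Or.inr (Or.inr (Or.inl rfl))
  | 3, _, _ => exact Or.inr (Or.inr (Or.inr rfl))
  | k + 4, hk, hc => simp [Rank3Row.adCheck, hk] at hc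
/-- **`ρ̄₄` ON EVERY ROW, hypothesis-free**: onto iff off row 64's two lists and not of kind `0, 1` on `adEx`.
[cite: DokchitserDokchitserMathZ2012, Theorem (2)] -/
theorem Rank3Row.hasSurjectiveModNGaloisRep_four_iff_of_getElem? {i : ℕ} {r : Rank3Row} (h : rank3Table[i]? = some r) :
    r.curve.HasSurjectiveModNGaloisRep 4 ↔
      redTwoAt i = none ∧ c3At i = none ∧ ∀ v : ℤ, adExAt i ≠ some (0, v) ∧ adExAt i ≠ some (1, v) := by
  haveI := isElliptic_of_mem (List.mem_of_getElem? h)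
  constructor
  · intro h4
    have h2 := ((DokchitserDokchitser2012.hasSurjectiveModNGaloisRep_four_iff r.curve).mp h4).1
    obtain ⟨hX, h3⟩ := (Rank3Row.hasSurjectiveModNGaloisRep_two_iff_of_getElem? h).mp h2
    exact ⟨hX, h3, fun v => ⟨fun hk => (Rank3Row.not_hasSurjectiveModNGaloisRep_four_of_adExAt0 h hk).2.2 h4,
      fun hk => (Rank3Row.not_hasSurjectiveModNGaloisRep_four_of_adExAt1 h hk).2.2.2 h4⟩⟩
  · rintro ⟨hX, h3, hne⟩
    cases hk : adExAt i with
    | none =>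
      have hc := Rank3Row.adCheck_of_getElem? h
      simp only [Rank3Row.adCheck, hk, h3, hX, Option.isSome_none, Bool.or_false, Bool.and_eq_true] at hc
      exact Rank3Row.hasSurjectiveModNGaloisRep_four_of_adCore h hX h3 hc.1.1
    | some p =>
      obtain ⟨k, v⟩ := p
      rcases Rank3Row.kind_le_three_of_adExAt h hk with rfl | rfl | rfl | rfl
      · exact absurd hk (hne v).1
      · exact absurd hk (hne v).2
      · exact (Rank3Row.four_not_eight_of_adExAt h hk (Or.inl rfl)).1
      · exact (Rank3Row.four_not_eight_of_adExAt h hk (Or.inr rfl)).1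
/-- **`ρ̄₈` AND THE 2-ADIC IMAGE ON EVERY ROW, hypothesis-free**: onto at `8` ⟺ onto at every `2ⁿ` ⟺ off row 64's two lists
and off `adEx`. [cite: DokchitserDokchitserMathZ2012, Theorem] [cite: RouseZureickbrown2015, §3 Lemma] -/
theorem Rank3Row.twoAdic_surjective_iff_of_getElem? {i : ℕ} {r : Rank3Row} (h : rank3Table[i]? = some r) :
    (r.curve.HasSurjectiveModNGaloisRep 8 ↔ redTwoAt i = none ∧ c3At i = none ∧ adExAt i = none) ∧
    ((∀ n : ℕ, r.curve.HasSurjectiveModNGaloisRep ((2 : ℤ) ^ n)) ↔ redTwoAt i = none ∧ c3At i = none ∧ adExAt i = none) := by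
  haveI := isElliptic_of_mem (List.mem_of_getElem? h)
  have key : r.curve.HasSurjectiveModNGaloisRep 8 → redTwoAt i = none ∧ c3At i = none ∧ adExAt i = none := by
    intro h8
    have h4 := ((DokchitserDokchitser2012.hasSurjectiveModNGaloisRep_eight_iff r.curve).mp h8).1
    obtain ⟨hX, h3, hne⟩ := (Rank3Row.hasSurjectiveModNGaloisRep_four_iff_of_getElem? h).mp h4
    refine ⟨hX, h3, ?_⟩
    cases hk : adExAt i with
    | none => rfl
    | some p =>
      obtain ⟨k, v⟩ := p
      rcases Rank3Row.kind_le_three_of_adExAt h hk with rfl | rfl | rfl | rfl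
      · exact absurd hk (hne v).1
      · exact absurd hk (hne v).2
      · exact absurd h8 (Rank3Row.four_not_eight_of_adExAt h hk (Or.inl rfl)).2.2
      · exact absurd h8 (Rank3Row.four_not_eight_of_adExAt h hk (Or.inr rfl)).2.2
  exact ⟨⟨key, fun hh => by simpa using Rank3Row.twoAdic_surjective_of_getElem? h hh.1 hh.2.1 hh.2.2 3⟩,
    ⟨fun hall => key (by simpa using hall 3), fun hh => Rank3Row.twoAdic_surjective_of_getElem? h hh.1 hh.2.1 hh.2.2⟩⟩

/-! ## §6 Samples -/
/-- **`5077a1`** (row `0`): `ρ̄_{E,2ⁿ}` onto for every `n`. [cite: DokchitserDokchitserMathZ2012, Theorem] -/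
theorem twoAdic_surjective_5077a1 {r : Rank3Row} (h : rank3Table[0]? = some r) (n : ℕ) :
    r.curve.HasSurjectiveModNGaloisRep ((2 : ℤ) ^ n) :=
  Rank3Row.twoAdic_surjective_of_getElem? h (by decide +kernel) (by decide +kernel) (by decide +kernel) n
/-- **`48734b1`** (row `120`): `Δ = −3304²`; onto at `2`, not at `4`. [cite: DokchitserDokchitserMathZ2012, Theorem (2)] -/
theorem not_hasSurjectiveModNGaloisRep_four_48734b1 {r : Rank3Row} (h : rank3Table[120]? = some r) :
    r.curve.Δ = -(3304 : ℚ) ^ 2 ∧ r.curve.HasSurjectiveModNGaloisRep 2 ∧ ¬ r.curve.HasSurjectiveModNGaloisRep 4 := by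
  exact_mod_cast Rank3Row.not_hasSurjectiveModNGaloisRep_four_of_adExAt0 h (v := 3304) (by decide +kernel)
/-- **`431644b1`** (row `7511`): `q = 7316` is a root of `64q⁴ + 32Δq + c₄Δ`, so `j = −4t³(t+8)` has a rational solution; onto
at `2`, not at `4`. [cite: DokchitserDokchitserMathZ2012, Theorem (2) and Lemma] -/
theorem not_hasSurjectiveModNGaloisRep_four_431644b1 {r : Rank3Row} (h : rank3Table[7511]? = some r) :
    (∃ t : ℚ, r.curve.c₄ ^ 3 = -4 * t ^ 3 * (t + 8) * r.curve.Δ) ∧ r.curve.HasSurjectiveModNGaloisRep 2 ∧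
      ¬ r.curve.HasSurjectiveModNGaloisRep 4 :=
  (Rank3Row.not_hasSurjectiveModNGaloisRep_four_of_adExAt1 h (v := 58528) (by decide +kernel)).2
/-- **`359552l1`** (row `5569`): `−2Δ = 6784²`; onto at `4`, not at `8`. [cite: DokchitserDokchitserMathZ2012, Theorem (3)] -/
theorem four_not_eight_359552l1 {r : Rank3Row} (h : rank3Table[5569]? = some r) :
    r.curve.HasSurjectiveModNGaloisRep 4 ∧ ¬ r.curve.HasSurjectiveModNGaloisRep 8 :=
  have h' := Rank3Row.four_not_eight_of_adExAt h (k := 3) (v := 6784) (by decide +kernel) (Or.inr rfl)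
  ⟨h'.1, h'.2.2⟩

end Summit.BirchSwinnertonDyer.BirchSwinnertonDyer.Rank2Observatory
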